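import Mathlib
import Summits.ResolutionOfSingularities.ResolutionOfSingularities.Theorems.WeightedInvariantLocalWeightedDropPolyDescentCompare
import Summits.ResolutionOfSingularities.ResolutionOfSingularities.Theorems.WeightedInvariantLocalWeightedDropWildMonicShiftCoeff
import Summits.ResolutionOfSingularities.ResolutionOfSingularities.Theorems.WeightedInvariantLocalWeightedDropPolyDescentDissolve

/-!
# `WeightedInvariant.LocalWeightedDrop`, stub S3ρ, second key «monic polyhedron descent», piece (ρ-P) `stub_polyPrep` (Hironaka's vertex
# preparation for `y^d + Σ A_j y^j`): THE DISSOLUTION SEQUENCE scheduled by least degree, its invariants and its `u`-adic limit (half B, file 1)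

Crux item stmt-ResolutionOfSingularities-8899 `LocalWeightedDrop` (route `ResolutionOfSingularities/WeightedInvariant`), registered skeleton v30
(09f812eb3be8b7d8), stub S3ρ `stub_wildMonicSurfaceReductionWon`; LINE «monic polyhedron descent» of res-L1-w43-lead-1
(`L/res-L1-w43-lead-1/g3/poly_descent_line_v1.lean` 905148e143a15d9b), sub-stub (ρ-P) `PolyDescent.stub_polyPrep`.  [OURS · L1 W4.3, chain w43;
(ρ-P) lead res-type-061, second hand res-L1-w43-stub-2 (half A `…PolyDescentDissolve`: one dissolution step).  MODEL: Hironaka's vertex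
preparation (Cossart–Jannsen–Saito LNM 2270 Ch. 8); the degree-2 instance is lead-1's `MonicDescent.dseq/dpsi/…` (`…MonicDescentDissolveSeq`,
closing in `monicDescentPrep` p494822), of which this file is the slot-by-slot generalisation through `WildMonic.shift`.  Nothing here is a statement of any manuscript.]

A SOLVABLE VERTEX `P` of the `d!`-scaled Newton set of a tuple `A` (`PolyDescent.Solvable`: `P = d!·v` integral, vertex polynomial `(Y + λ)^d`)
is DISSOLVED by the re-centring `y ↦ y − λ u^v`, i.e. `A ↦ WildMonic.shift d A (monomial v (−λ))`.  THE SCHEDULE: at every stage dissolve a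
solvable vertex OF LEAST DEGREE (`dvertT`, parameter `dlamT`, increment `dincT`, step `dnextT`), giving the sequence of tuples `dseqT d A n` and the
accumulated re-centrings `dpsiT d A n` with `dseqT d A n = shift d A (dpsiT d A n)` (Taylor shifts compose additively: lead-1's `PolyDescent.shift_shift`).
INVARIANTS (from half A's one-step laws): positions stay positions (`isPosT_dseqT`); strict lower weight bounds persist (`lowerBound_dseqT`); a
dissolved vertex never returns (`dvertT_not_mem_dseqT`), so the dissolved vertices are pairwise distinct (`dvertT_ne_of_lt`); a NON-SOLVABLE vertex
of the original Newton set persists at every stage as the unique minimum of its exposing weight, with all its vertex coefficients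
(`nonSolvVertex_dseqT`).  THE LIMIT OBJECTS: the dissolved vertices are pairwise distinct lattice points, so their degrees tend to infinity
(`eventually_degree_dvertT_gt`); every coefficient of `dpsiT`/`dseqT` is eventually constant (`stabNT`, `coeff_dpsiT_stable`, `coeff_dseqT_stable`);
`psiLimT` / `bLimT` are the coefficientwise limits (`coeff_psiLimT`, `coeff_bLimT`, `agree_of_stageOfT_le`).  File 2 (`…PolyDescentPrepExists`, def-free)
proves that the limit is a well-preparing re-centring.
-/

set_option linter.dupNamespace false -- mandated namespace of this single-conjunct summit

noncomputable section

namespace Summit.ResolutionOfSingularities.ResolutionOfSingularities.Theorems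

namespace PolyDescent

open MvPowerSeries MonicDescent WildMonic

attribute [local instance] Classical.propDecidable

variable {k : Type} [Field k] {d : ℕ}

/-! ## Solvable vertices, the true exponent, solvability through the vertex coefficients -/

/-- A SOLVABLE VERTEX of the scaled Newton set of `A`: a vertex (unique minimum of a positive weight) that is solvable [OURS · L1 W4.3, scheduling predicate of (ρ-P)]. -/
def IsSolvVertex (d : ℕ) (A : Fin d → MvPowerSeries (Fin 2) k) (P : Fin 2 →₀ ℕ) : Prop :=
  IsVertex (newtonSet A) P ∧ Solvable d A P

/-- The TRUE EXPONENT `P/d!` of a scaled point (meaningful for integral points). -/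
def baseExp (d : ℕ) (P : Fin 2 →₀ ℕ) : Fin 2 →₀ ℕ :=
  Finsupp.single 0 (P 0 / d.factorial) + Finsupp.single 1 (P 1 / d.factorial)

/-- Components of `baseExp`. -/
@[simp] theorem baseExp_apply_zero (d : ℕ) (P : Fin 2 →₀ ℕ) : baseExp d P 0 = P 0 / d.factorial := by simp [baseExp]

/-- Components of `baseExp`. -/
@[simp] theorem baseExp_apply_one (d : ℕ) (P : Fin 2 →₀ ℕ) : baseExp d P 1 = P 1 / d.factorial := by simp [baseExp]

/-- An integral scaled point is `d!` times its true exponent. -/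
theorem factorial_smul_baseExp {P : Fin 2 →₀ ℕ} (hP : IsIntegral d P) : d.factorial • baseExp d P = P := by
  refine Literature.RingTheory.TwoVariableSeries.finsupp_fin2_ext ?_ ?_
  · simp only [Finsupp.smul_apply, smul_eq_mul, baseExp_apply_zero]; exact Nat.mul_div_cancel' (hP 0)
  · simp only [Finsupp.smul_apply, smul_eq_mul, baseExp_apply_one]; exact Nat.mul_div_cancel' (hP 1)

/-- Solvability depends only on the vertex coefficients at the point. -/
theorem solvable_iff_of_vertexCoeff_eq {A B : Fin d → MvPowerSeries (Fin 2) k} {P : Fin 2 →₀ ℕ}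
    (h : ∀ j : Fin d, vertexCoeff d B P j = vertexCoeff d A P j) : Solvable d B P ↔ Solvable d A P := by
  unfold Solvable
  simp only [h]

/-! ## The schedule: dissolve a solvable vertex of least degree -/

/-- There is a solvable vertex of least degree (if there is one at all). -/
theorem exists_min_isSolvVertex {A : Fin d → MvPowerSeries (Fin 2) k} (h : ∃ P, IsSolvVertex d A P) :
    ∃ P, IsSolvVertex d A P ∧ ∀ Q, IsSolvVertex d A Q → Finsupp.degree P ≤ Finsupp.degree Q := by
  have hex : ∃ n, ∃ P, IsSolvVertex d A P ∧ Finsupp.degree P = n := by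
    obtain ⟨P, hP⟩ := h; exact ⟨_, P, hP, rfl⟩
  obtain ⟨P, hP, hdeg⟩ := Nat.find_spec hex
  refine ⟨P, hP, fun Q hQ => ?_⟩
  rw [hdeg]
  exact Nat.find_min' hex ⟨Q, hQ, rfl⟩

/-- THE VERTEX DISSOLVED at `A`: a solvable vertex of least degree (junk `0` if none). -/
def dvertT (d : ℕ) (A : Fin d → MvPowerSeries (Fin 2) k) : Fin 2 →₀ ℕ :=
  if h : ∃ P, IsSolvVertex d A P then Classical.choose (exists_min_isSolvVertex h) else 0

/-- Specification of `dvertT`. -/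
theorem dvertT_spec {A : Fin d → MvPowerSeries (Fin 2) k} (h : ∃ P, IsSolvVertex d A P) :
    IsSolvVertex d A (dvertT d A) ∧ ∀ Q, IsSolvVertex d A Q → Finsupp.degree (dvertT d A) ≤ Finsupp.degree Q := by
  unfold dvertT; rw [dif_pos h]; exact Classical.choose_spec (exists_min_isSolvVertex h)

/-- THE PARAMETER `λ` of the dissolved vertex (vertex polynomial `(Y + λ)^d`; junk `0` if none). -/
def dlamT (d : ℕ) (A : Fin d → MvPowerSeries (Fin 2) k) : k :=
  if h : ∃ P, IsSolvVertex d A P then Classical.choose (dvertT_spec h).1.2.2 else 0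

/-- Specification of `dlamT`: the vertex coefficients at the dissolved vertex are `C(d,j) λ^{d−j}`. -/
theorem dlamT_spec {A : Fin d → MvPowerSeries (Fin 2) k} (h : ∃ P, IsSolvVertex d A P) :
    ∀ j : Fin d, vertexCoeff d A (dvertT d A) j = ((d.choose (j : ℕ) : ℕ) : k) * dlamT d A ^ (d - (j : ℕ)) := by
  unfold dlamT; rw [dif_pos h]; exact Classical.choose_spec (dvertT_spec h).1.2.2

/-- THE INCREMENT of the re-centring at `A`: `−λ · u^{P/d!}` for the dissolved vertex `P` (zero if there is no solvable vertex). -/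
def dincT (d : ℕ) (A : Fin d → MvPowerSeries (Fin 2) k) : MvPowerSeries (Fin 2) k :=
  if ∃ P, IsSolvVertex d A P then monomial (baseExp d (dvertT d A)) (-dlamT d A) else 0

/-- ONE SCHEDULED STEP: re-centre by the increment. -/
def dnextT (d : ℕ) (A : Fin d → MvPowerSeries (Fin 2) k) : Fin d → MvPowerSeries (Fin 2) k := shift d A (dincT d A)

/-- `dincT` when a solvable vertex exists. -/
theorem dincT_of_exists {A : Fin d → MvPowerSeries (Fin 2) k} (h : ∃ P, IsSolvVertex d A P) :
    dincT d A = monomial (baseExp d (dvertT d A)) (-dlamT d A) := by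
  unfold dincT; rw [if_pos h]

/-- `dincT` vanishes when no solvable vertex exists. -/
theorem dincT_of_not {A : Fin d → MvPowerSeries (Fin 2) k} (h : ¬ ∃ P, IsSolvVertex d A P) : dincT d A = 0 := by
  unfold dincT; rw [if_neg h]

/-- `dnextT` when a solvable vertex exists. -/
theorem dnextT_of_exists {A : Fin d → MvPowerSeries (Fin 2) k} (h : ∃ P, IsSolvVertex d A P) :
    dnextT d A = shift d A (monomial (baseExp d (dvertT d A)) (-dlamT d A)) := by
  unfold dnextT; rw [dincT_of_exists h]

/-- `dnextT` is the identity when no solvable vertex exists. -/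
theorem dnextT_of_not {A : Fin d → MvPowerSeries (Fin 2) k} (h : ¬ ∃ P, IsSolvVertex d A P) : dnextT d A = A := by
  unfold dnextT; rw [dincT_of_not h, shift_zero]

/-- THE SEQUENCE OF TUPLES. -/
def dseqT (d : ℕ) (A : Fin d → MvPowerSeries (Fin 2) k) : ℕ → (Fin d → MvPowerSeries (Fin 2) k)
  | 0 => A
  | n + 1 => dnextT d (dseqT d A n)

/-- THE ACCUMULATED RE-CENTRING. -/
def dpsiT (d : ℕ) (A : Fin d → MvPowerSeries (Fin 2) k) : ℕ → MvPowerSeries (Fin 2) k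
  | 0 => 0
  | n + 1 => dpsiT d A n + dincT d (dseqT d A n)

/-- Stage `0`. -/
@[simp] theorem dseqT_zero (A : Fin d → MvPowerSeries (Fin 2) k) : dseqT d A 0 = A := rfl

/-- Successor stage. -/
theorem dseqT_succ (A : Fin d → MvPowerSeries (Fin 2) k) (n : ℕ) : dseqT d A (n + 1) = dnextT d (dseqT d A n) := rfl

/-- Accumulated re-centring at stage `0`. -/
@[simp] theorem dpsiT_zero (A : Fin d → MvPowerSeries (Fin 2) k) : dpsiT d A 0 = 0 := rfl

/-- Accumulated re-centring at a successor stage. -/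
theorem dpsiT_succ (A : Fin d → MvPowerSeries (Fin 2) k) (n : ℕ) : dpsiT d A (n + 1) = dpsiT d A n + dincT d (dseqT d A n) := rfl

/-! ## The stages are re-centrings of `A` -/

/-- Every stage is the re-centring of `A` by the accumulated re-centring. -/
theorem dseqT_eq_shift (A : Fin d → MvPowerSeries (Fin 2) k) (n : ℕ) : dseqT d A n = shift d A (dpsiT d A n) := by
  induction n with
  | zero => rw [dseqT_zero, dpsiT_zero, shift_zero]
  | succ n ih => rw [dseqT_succ, dnextT, dpsiT_succ, add_comm, ← shift_shift, ← ih]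

/-! ## Active stages -/

/-- ACTIVE stage: there is a solvable vertex to dissolve [OURS · L1 W4.3, scheduling predicate of (ρ-P)]. -/
def DActiveT (d : ℕ) (A : Fin d → MvPowerSeries (Fin 2) k) (n : ℕ) : Prop := ∃ P, IsSolvVertex d (dseqT d A n) P

/-- The facts about an active stage: the dissolved vertex `P = d!·v` is a vertex of the stage's Newton set, integral, with vertex coefficients
`C(d,j) λ^{d−j}`, and the next stage is the re-centring by `−λ u^v`. -/
theorem dactiveT_spec {A : Fin d → MvPowerSeries (Fin 2) k} {n : ℕ} (h : DActiveT d A n) :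
    IsVertex (newtonSet (dseqT d A n)) (dvertT d (dseqT d A n)) ∧
    d.factorial • baseExp d (dvertT d (dseqT d A n)) = dvertT d (dseqT d A n) ∧
    (∀ j : Fin d, vertexCoeff d (dseqT d A n) (d.factorial • baseExp d (dvertT d (dseqT d A n))) j =
      ((d.choose (j : ℕ) : ℕ) : k) * dlamT d (dseqT d A n) ^ (d - (j : ℕ))) ∧
    dseqT d A (n + 1) = shift d (dseqT d A n) (monomial (baseExp d (dvertT d (dseqT d A n))) (-dlamT d (dseqT d A n))) := by
  obtain ⟨⟨hv, hint, -⟩, -⟩ := dvertT_spec h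
  have hP := factorial_smul_baseExp hint
  refine ⟨hv, hP, ?_, ?_⟩
  · rw [hP]; exact dlamT_spec h
  · rw [dseqT_succ, dnextT_of_exists h]

/-- The exposing weight of the vertex dissolved at an active stage. -/
theorem exists_weight_dvertT {A : Fin d → MvPowerSeries (Fin 2) k} {n : ℕ} (h : DActiveT d A n) :
    ∃ w : Fin 2 → ℕ, (∀ i, 0 < w i) ∧ ∀ Q ∈ newtonSet (dseqT d A n), Q ≠ d.factorial • baseExp d (dvertT d (dseqT d A n)) →
      Finsupp.weight w (d.factorial • baseExp d (dvertT d (dseqT d A n))) < Finsupp.weight w Q := by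
  obtain ⟨⟨-, w, hw, hmin⟩, hP, -, -⟩ := dactiveT_spec h
  rw [← hP] at hmin
  exact ⟨w, hw, hmin⟩

/-- The dissolved vertex lies in the stage's Newton set. -/
theorem smul_baseExp_dvertT_mem {A : Fin d → MvPowerSeries (Fin 2) k} {n : ℕ} (h : DActiveT d A n) :
    d.factorial • baseExp d (dvertT d (dseqT d A n)) ∈ newtonSet (dseqT d A n) := by
  obtain ⟨⟨hmem, -⟩, hP, -, -⟩ := dactiveT_spec h
  rw [hP]; exact hmem

/-! ## Invariants of the finite stages -/

/-- POSITIONS STAY POSITIONS along the sequence. -/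
theorem isPosT_dseqT {A : Fin d → MvPowerSeries (Fin 2) k} (hA : IsPosT d A) (n : ℕ) : IsPosT d (dseqT d A n) := by
  induction n with
  | zero => exact hA
  | succ n ih =>
    by_cases h : DActiveT d A n
    · obtain ⟨-, -, -, hstep⟩ := dactiveT_spec h
      rw [hstep]
      exact isPosT_shift_monomial ih (two_le_degree_of_mem_newtonSet ih (smul_baseExp_dvertT_mem h)) _
    · rw [dseqT_succ, dnextT_of_not h]; exact ih

/-- At an active stage of a position the true exponent of the dissolved vertex has degree `≥ 2`. -/
theorem two_le_degree_baseExp_dvertT {A : Fin d → MvPowerSeries (Fin 2) k} (hA : IsPosT d A) {n : ℕ} (h : DActiveT d A n) :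
    2 ≤ baseExp d (dvertT d (dseqT d A n)) 0 + baseExp d (dvertT d (dseqT d A n)) 1 :=
  two_le_degree_of_mem_newtonSet (isPosT_dseqT hA n) (smul_baseExp_dvertT_mem h)

/-- The degree of the dissolved vertex is `d!` times the degree of its true exponent. -/
theorem degree_dvertT_eq {A : Fin d → MvPowerSeries (Fin 2) k} {n : ℕ} (h : DActiveT d A n) :
    Finsupp.degree (dvertT d (dseqT d A n)) = d.factorial * (baseExp d (dvertT d (dseqT d A n)) 0 + baseExp d (dvertT d (dseqT d A n)) 1) := by
  obtain ⟨-, hP, -, -⟩ := dactiveT_spec h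
  conv_lhs => rw [← hP]
  rw [Finsupp.degree_eq_sum, Fin.sum_univ_two]
  simp only [Finsupp.smul_apply, smul_eq_mul]
  ring

/-- STRICT LOWER WEIGHT BOUNDS PERSIST along the sequence. -/
theorem lowerBound_dseqT {A : Fin d → MvPowerSeries (Fin 2) k} (w : Fin 2 → ℕ) {L : ℕ} {n : ℕ}
    (hL : ∀ Q ∈ newtonSet (dseqT d A n), L < Finsupp.weight w Q) (m : ℕ) (hm : n ≤ m) :
    ∀ Q ∈ newtonSet (dseqT d A m), L < Finsupp.weight w Q := by
  induction m, hm using Nat.le_induction with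
  | base => exact hL
  | succ m _ ih =>
    by_cases h : DActiveT d A m
    · obtain ⟨-, -, -, hstep⟩ := dactiveT_spec h
      rw [hstep]
      intro Q hQ
      exact le_weight_of_mem_newtonSet_shift_monomial _ _ _ w (L + 1) (fun P hP => ih P hP) (ih _ (smul_baseExp_dvertT_mem h)) hQ
    · rw [dseqT_succ, dnextT_of_not h]; exact ih

/-- THE DISSOLVED VERTEX STAYS STRICTLY BELOW every later Newton set (for its exposing weight); in particular it never reappears. -/
theorem dvertT_not_mem_dseqT {A : Fin d → MvPowerSeries (Fin 2) k} {n : ℕ} (h : DActiveT d A n) (m : ℕ) (hm : n < m) :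
    dvertT d (dseqT d A n) ∉ newtonSet (dseqT d A m) := by
  obtain ⟨w, -, hmin⟩ := exists_weight_dvertT h
  obtain ⟨-, hP, hsol, hstep⟩ := dactiveT_spec h
  have hgt : ∀ Q ∈ newtonSet (dseqT d A (n + 1)),
      Finsupp.weight w (d.factorial • baseExp d (dvertT d (dseqT d A n))) < Finsupp.weight w Q := by
    rw [hstep]
    intro Q hQ
    exact lt_weight_of_mem_newtonSet_dissolve _ _ _ hsol w hmin hQ
  intro hmemm
  rw [← hP] at hmemm
  exact lt_irrefl _ (lowerBound_dseqT w hgt m hm _ hmemm)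

/-- DISSOLVED VERTICES ARE PAIRWISE DISTINCT. -/
theorem dvertT_ne_of_lt {A : Fin d → MvPowerSeries (Fin 2) k} {n m : ℕ} (hn : DActiveT d A n) (hm : DActiveT d A m) (hnm : n < m) :
    dvertT d (dseqT d A n) ≠ dvertT d (dseqT d A m) := by
  intro heq
  have hmemm := (dactiveT_spec hm).1.1
  have := dvertT_not_mem_dseqT hn m hnm
  rw [heq] at this
  exact this hmemm

/-- A NON-SOLVABLE VERTEX OF THE ORIGINAL TUPLE PERSISTS at every stage: same vertex coefficients, still in the Newton set, still the unique minimum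
of its exposing weight. -/
theorem nonSolvVertex_dseqT {A : Fin d → MvPowerSeries (Fin 2) k} {P : Fin 2 →₀ ℕ} (hPmem : P ∈ newtonSet A) (hPns : ¬ Solvable d A P)
    (w : Fin 2 → ℕ) (hmin : ∀ Q ∈ newtonSet A, Q ≠ P → Finsupp.weight w P < Finsupp.weight w Q) (n : ℕ) :
    (∀ j : Fin d, vertexCoeff d (dseqT d A n) P j = vertexCoeff d A P j) ∧ P ∈ newtonSet (dseqT d A n) ∧
      ∀ Q ∈ newtonSet (dseqT d A n), Q ≠ P → Finsupp.weight w P < Finsupp.weight w Q := by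
  induction n with
  | zero => exact ⟨fun _ => rfl, hPmem, hmin⟩
  | succ n ih =>
    obtain ⟨hcoef, hmem, hminn⟩ := ih
    by_cases h : DActiveT d A n
    · obtain ⟨hvert, hP', hsol, hstep⟩ := dactiveT_spec h
      -- the dissolved vertex is solvable at stage `n`, `P` is not: they differ
      have hne : P ≠ d.factorial • baseExp d (dvertT d (dseqT d A n)) := by
        intro hPe
        apply hPns
        rw [← solvable_iff_of_vertexCoeff_eq hcoef, hPe, hP']
        exact (dvertT_spec h).1.2
      rw [hstep]
      have hmem' := smul_baseExp_dvertT_mem h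
      have hc : ∀ j : Fin d, vertexCoeff d (shift d (dseqT d A n) (monomial (baseExp d (dvertT d (dseqT d A n)))
          (-dlamT d (dseqT d A n)))) P j = vertexCoeff d A P j :=
        fun j => (vertexCoeff_shift_monomial_of_ne _ _ _ w hne hmem' hminn j).trans (hcoef j)
      refine ⟨hc, ?_, fun Q hQ hQP => lt_weight_of_mem_newtonSet_shift_monomial_of_ne _ _ _ w hne hmem' hminn hQ hQP⟩
      obtain ⟨j, hj⟩ := exists_vertexCoeff_ne_zero_of_mem hPmem
      exact mem_newtonSet_of_vertexCoeff_ne_zero (j := j) (by rw [hc j]; exact hj)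
    · rw [dseqT_succ, dnextT_of_not h]; exact ⟨hcoef, hmem, hminn⟩

/-! ## The dissolved vertices march off to infinity -/

/-- EVENTUALLY LARGE: for every `D`, from some stage on every dissolved vertex has degree `> D`. -/
theorem eventually_degree_dvertT_gt (A : Fin d → MvPowerSeries (Fin 2) k) (D : ℕ) :
    ∃ N, ∀ n, N ≤ n → DActiveT d A n → D < Finsupp.degree (dvertT d (dseqT d A n)) := by
  set T : Set ℕ := {n | DActiveT d A n ∧ Finsupp.degree (dvertT d (dseqT d A n)) ≤ D} with hT
  have hinj : Set.InjOn (fun n => dvertT d (dseqT d A n)) T := by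
    intro n hn m hm heq
    by_contra hne
    rcases Nat.lt_or_gt_of_ne hne with hlt | hlt
    · exact dvertT_ne_of_lt hn.1 hm.1 hlt heq
    · exact dvertT_ne_of_lt hm.1 hn.1 hlt heq.symm
  have himg : ((fun n => dvertT d (dseqT d A n)) '' T).Finite := by
    refine (Finset.finite_toSet (Finset.Iic (Finsupp.single 0 D + Finsupp.single 1 D : Fin 2 →₀ ℕ))).subset ?_
    rintro P ⟨n, hn, rfl⟩
    rw [Finset.mem_coe, Finset.mem_Iic]
    have hdeg := hn.2
    rw [Finsupp.degree_eq_sum, Fin.sum_univ_two] at hdeg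
    intro i
    fin_cases i <;> simp <;> omega
  have hfin : T.Finite := Set.Finite.of_finite_image himg hinj
  obtain ⟨M, hM⟩ := hfin.bddAbove
  refine ⟨M + 1, fun n hn hact => ?_⟩
  by_contra hle
  push Not at hle
  have : n ∈ T := ⟨hact, hle⟩
  have := hM this
  omega

/-- The stabilisation index for the exponent `f`: from it on, active stages dissolve vertices of degree `> d!·|f|`. -/
def stabNT (d : ℕ) (A : Fin d → MvPowerSeries (Fin 2) k) (f : Fin 2 →₀ ℕ) : ℕ :=
  Classical.choose (eventually_degree_dvertT_gt A (d.factorial * Finsupp.degree f))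

/-- Beyond `stabNT f`, the true exponent `v` of every dissolved vertex has `|v| > |f|`. -/
theorem degree_lt_degree_baseExp_of_stabNT_le {A : Fin d → MvPowerSeries (Fin 2) k} {f : Fin 2 →₀ ℕ} {n : ℕ}
    (hn : stabNT d A f ≤ n) (hact : DActiveT d A n) :
    f 0 + f 1 < baseExp d (dvertT d (dseqT d A n)) 0 + baseExp d (dvertT d (dseqT d A n)) 1 := by
  have h := Classical.choose_spec (eventually_degree_dvertT_gt A (d.factorial * Finsupp.degree f)) n hn hact
  rw [degree_dvertT_eq hact] at h
  have hdeg : Finsupp.degree f = f 0 + f 1 := by rw [Finsupp.degree_eq_sum, Fin.sum_univ_two]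
  rw [hdeg] at h
  exact Nat.lt_of_mul_lt_mul_left h

/-- Beyond `stabNT f`, the true exponent of a dissolved vertex is not `≤ f`. -/
theorem not_baseExp_le_of_stabNT_le {A : Fin d → MvPowerSeries (Fin 2) k} {f : Fin 2 →₀ ℕ} {n : ℕ}
    (hn : stabNT d A f ≤ n) (hact : DActiveT d A n) : ¬ baseExp d (dvertT d (dseqT d A n)) ≤ f := by
  intro hle
  have hlt := degree_lt_degree_baseExp_of_stabNT_le hn hact
  have h0 := hle 0
  have h1 := hle 1
  omega

/-! ## Coefficients stabilise -/

/-- COEFFICIENTS OF THE ACCUMULATED RE-CENTRINGS STABILISE. -/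
theorem coeff_dpsiT_stable (A : Fin d → MvPowerSeries (Fin 2) k) (f : Fin 2 →₀ ℕ) (n : ℕ) (hn : stabNT d A f ≤ n) :
    coeff f (dpsiT d A n) = coeff f (dpsiT d A (stabNT d A f)) := by
  induction n, hn using Nat.le_induction with
  | base => rfl
  | succ n hmn ih =>
    rw [dpsiT_succ, map_add, ih]
    by_cases hact : DActiveT d A n
    · rw [dincT_of_exists hact, coeff_monomial, if_neg, add_zero]
      intro heq
      exact not_baseExp_le_of_stabNT_le hmn hact (heq ▸ le_rfl)
    · rw [dincT_of_not hact, map_zero, add_zero]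

/-- COEFFICIENTS OF EVERY SLOT STABILISE. -/
theorem coeff_dseqT_stable (A : Fin d → MvPowerSeries (Fin 2) k) (f : Fin 2 →₀ ℕ) (j : Fin d) (n : ℕ) (hn : stabNT d A f ≤ n) :
    coeff f (dseqT d A n j) = coeff f (dseqT d A (stabNT d A f) j) := by
  induction n, hn using Nat.le_induction with
  | base => rfl
  | succ n hmn ih =>
    rw [← ih]
    by_cases hact : DActiveT d A n
    · obtain ⟨-, -, -, hstep⟩ := dactiveT_spec hact
      rw [hstep]
      exact coeff_shift_monomial_of_not_le _ _ _ j (not_baseExp_le_of_stabNT_le hmn hact)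
    · rw [dseqT_succ, dnextT_of_not hact]

/-- THE LIMIT RE-CENTRING (coefficientwise eventual value). -/
def psiLimT (d : ℕ) (A : Fin d → MvPowerSeries (Fin 2) k) : MvPowerSeries (Fin 2) k :=
  fun f => coeff f (dpsiT d A (stabNT d A f))

/-- THE LIMIT TUPLE (coefficientwise eventual value, slot by slot). -/
def bLimT (d : ℕ) (A : Fin d → MvPowerSeries (Fin 2) k) : Fin d → MvPowerSeries (Fin 2) k :=
  fun j f => coeff f (dseqT d A (stabNT d A f) j)

/-- The limit re-centring agrees with all late stages. -/
theorem coeff_psiLimT (A : Fin d → MvPowerSeries (Fin 2) k) (f : Fin 2 →₀ ℕ) (n : ℕ) (hn : stabNT d A f ≤ n) :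
    coeff f (psiLimT d A) = coeff f (dpsiT d A n) := by
  rw [coeff_dpsiT_stable A f n hn]; rfl

/-- The limit tuple agrees with all late stages. -/
theorem coeff_bLimT (A : Fin d → MvPowerSeries (Fin 2) k) (f : Fin 2 →₀ ℕ) (j : Fin d) (n : ℕ) (hn : stabNT d A f ≤ n) :
    coeff f (bLimT d A j) = coeff f (dseqT d A n j) := by
  rw [coeff_dseqT_stable A f j n hn]; rfl

/-- The stage from which on the limits agree with the stages at all exponents `≤ D`. -/
def stageOfT (d : ℕ) (A : Fin d → MvPowerSeries (Fin 2) k) (D : Fin 2 →₀ ℕ) : ℕ := (Finset.Iic D).sup (stabNT d A)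

/-- Agreement of the limits with every stage `≥ stageOfT D` at all exponents `≤ D`. -/
theorem agree_of_stageOfT_le (A : Fin d → MvPowerSeries (Fin 2) k) (D : Fin 2 →₀ ℕ) (n : ℕ) (hn : stageOfT d A D ≤ n) :
    ∀ f ≤ D, coeff f (psiLimT d A) = coeff f (dpsiT d A n) ∧ ∀ j : Fin d, coeff f (bLimT d A j) = coeff f (dseqT d A n j) := by
  intro f hf
  have hle : stabNT d A f ≤ n := le_trans (Finset.le_sup (f := stabNT d A) (Finset.mem_Iic.mpr hf)) hn
  exact ⟨coeff_psiLimT A f _ hle, fun j => coeff_bLimT A f j _ hle⟩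


end PolyDescent

end Summit.ResolutionOfSingularities.ResolutionOfSingularities.Theorems

end
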